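import Summits.QuantumFields.YangMills.Theorems.F4SubCurvatureDoorSubCurvatureKernelMollifiedPD
import Summits.QuantumFields.YangMills.Theorems.F4SubCurvatureDoorSubCurvatureKernelVagueCluster
import Summits.QuantumFields.YangMills.Theorems.F4SubCurvatureDoorSubCurvatureKernelLFTest
import Summits.QuantumFields.YangMills.Theorems.F4SubCurvatureDoorSubCurvatureKernelHalfSpaceTools
import Mathlib
import HarnessLib

/-!
# Route `F4SubCurvatureDoor`, crux `SubCurvatureKernel` ⟨stmt-QuantumFields-23036⟩ — soft half, input (C) «continuity off 0»,
# part 5b: a CONTINUOUS VERSION of the kernel ON EVERY HALF-SPACE `{y₀ < −δ}`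

Helper file (`--supports stmt-QuantumFields-23036 --as helper`; free-hands seat `ym-line-frs-p2` g18).  Definition-free, 0 sorry,
standard axioms.  No item is closed; no summit, no crux and no mass gap is proved by this file.

WHAT.  ★ `exists_continuous_halfSpace`: let `S₁` satisfy `RPPos` and let the measurable real kernel `K` (crux bound
`|K u| ≤ A (1 + ‖u‖⁻¹)⁸`, a.e. invariant under the spatial inversion `−θ`) represent `S₁ 2` on compactly supported off-diagonal
test functions (clause 6).  Then for every `δ > 0` there is a CONTINUOUS `Kc : ℝ⁴ → ℝ` with `K y = Kc y` for a.e. `y` with `y₀ < −δ`.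
Proof (HOME INBOX owner g23 16:54:59Z, steps (i)–(iii)): mollified kernels `κₙ` at bump radius `εₙ → 0` (✓`exists_mollifiedKernel`),
their Laplace–Fourier measures `μₙ` (✓`exists_laplaceFourier_mollified`), the tilted finite measures `νₙ = e^{−t₀E} μₙ` of mass
`κₙ(−δ, 0⃗) ≤ A (1 + (δ/3)⁻¹)⁸`, a vague cluster point `ν` (✓`exists_finiteMeasure_mapClusterPt`), the jointly continuous
`K̃(t, z⃗) := ∫ e^{min(E,0) − t₊E₊} cos⟪q, z⃗⟫ dν` (✓`continuous_lfEval`), and the identification `K(−(δ + t), z⃗) = K̃(t, z⃗)` for a.e.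
`t > 0`: against a test function `χ` supported in `{t > 0}`, `∫ χ κₙ∘w = ∫ Φ_χ dνₙ` (Fubini ✓`integral_lfTest_eq`, `Φ_χ` vanishing at
infinity ✓`exists_lfTest`), `∫ χ κₙ∘w → ∫ χ K∘w` (tested form of ✓`exists_mollifiedKernel` + uniform continuity), the cluster value is
the limit (✓`eq_of_mapClusterPt_of_tendsto`), `= ∫ χ K̃`; then ✓`IsOpen.ae_eq_zero_of_integral_contDiff_smul_eq_zero` and transport
along the measure-preserving `(t, z⃗) ↦ (−(δ + t), z⃗)` (✓`exists_shiftedTimeSpace_equiv`, ✓`tendsto_bumpAverage`, part 5a).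

HONEST LABEL: the analytic heart of input (C) of the SOFT half of ⟨23036⟩ (the gluing over the four axes is the next file); the
SUB-CURVATURE clause (asymptotic freedom) is the crux, untouched; ⟨23036⟩ is an open problem; the Yang–Mills mass gap is NOT proved;
no summit is proved by a line.
-/

set_option autoImplicit false

noncomputable section

open scoped SchwartzMap BigOperators ContDiff InnerProductSpace Topology NNReal ENNReal BoundedContinuousFunction
open MeasureTheory Filter Set Metric Function
open Literature.MathematicalPhysics.QuantumFieldTheory Literature.MathematicalPhysics.QuantumLattice
open Literature.MathematicalPhysics.AQFT
open Summit.QuantumFields.YangMills.Cruxes.OSLegsFromFemtoAndGap.DlrCollarTransfer (RPPos)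
open Summit.QuantumFields.YangMills.Theorems.NPointIsotropy.Negative (E4)
open Summit.QuantumFields.YangMills.Theorems.F4SubCurvatureDoorSubCurvatureKernelMollifier (exists_mollifiedKernel)
open Summit.QuantumFields.YangMills.Theorems.F4SubCurvatureDoorSubCurvatureKernelMollifiedPD (exists_laplaceFourier_mollified)
open Summit.QuantumFields.YangMills.Theorems.F4SubCurvatureDoorSubCurvatureKernelVagueCluster
  (exists_finiteMeasure_mapClusterPt eq_of_mapClusterPt_of_tendsto)
open Summit.QuantumFields.YangMills.Theorems.F4SubCurvatureDoorSubCurvatureKernelLFTest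
  (exists_lfTest integral_lfTest_eq continuous_lfEval abs_lfIntegrand_le_one continuous_lfIntegrand)
open Summit.QuantumFields.YangMills.Theorems.F4SubCurvatureDoorSubCurvatureKernelHalfSpaceTools
  (exists_shiftedTimeSpace_equiv continuous_shiftedTimeSpace tendsto_bumpAverage)

namespace Summit.QuantumFields.YangMills.Theorems.F4SubCurvatureDoorSubCurvatureKernelHalfSpace

/-! ## §2 ★ A continuous version on every half-space -/

/-- ★ **CONTINUOUS VERSION ON A HALF-SPACE.**  See the module docstring. [cite: OS1973, §2 (E2)] [cite: GlimmJaffeQP1987, §6.2]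
[cite: Billingsley1999, Thm. 5.1] -/
theorem exists_continuous_halfSpace (S₁ : SchwingerFamily E4) (hRP : RPPos S₁) (K : E4 → ℝ) (hKm : Measurable K) {A : ℝ}
    (hKb : ∀ u, |K u| ≤ A * (1 + ‖u‖⁻¹) ^ 8) (hKP : ∀ᵐ u : E4, K (-(timeReflection 4 u)) = K u)
    (hrep : ∀ F : 𝓢((Fin 2 → E4), ℂ), IsOffDiagonal F → HasCompactSupport (F : (Fin 2 → E4) → ℂ) →
      Integrable (fun x : Fin 2 → E4 => (K (x 0 - x 1) : ℂ) * F x) ∧ S₁ 2 F = ∫ x : Fin 2 → E4, (K (x 0 - x 1) : ℂ) * F x)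
    {δ : ℝ} (hδ : 0 < δ) :
    ∃ Kc : E4 → ℝ, Continuous Kc ∧ ∀ᵐ y : E4, y 0 < -δ → K y = Kc y := by
  classical
  set θ := timeReflection 4 with hθ
  -- constants
  have hA : 0 ≤ A := by
    have h1 := hKb 0; have h2 : (1 + ‖(0 : E4)‖⁻¹) ^ 8 = 1 := by simp
    rw [h2, mul_one] at h1; exact (abs_nonneg _).trans h1
  set s₀ : ℝ := δ / 3 with hs₀
  have hs₀pos : 0 < s₀ := by positivity
  have hδs : 2 * s₀ + s₀ = δ := by rw [hs₀]; ring
  set B : ℝ := A * (1 + s₀⁻¹) ^ 8 with hB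
  have hB0 : 0 ≤ B := by positivity
  set K' : E4 → ℝ := fun ξ => if s₀ ≤ ‖ξ‖ then K ξ else 0 with hK'
  have hK'b : ∀ ξ, |K' ξ| ≤ B := by
    intro ξ
    simp only [hK']
    split_ifs with h
    · refine (hKb ξ).trans (mul_le_mul_of_nonneg_left ?_ hA)
      have hξ : 0 < ‖ξ‖ := hs₀pos.trans_le h
      have : ‖ξ‖⁻¹ ≤ s₀⁻¹ := by rw [inv_le_inv₀ hξ hs₀pos]; exact h
      exact pow_le_pow_left₀ (by positivity) (by linarith) 8
    · rw [abs_zero]; exact hB0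
  -- the radii `εₙ → 0`
  set ε : ℕ → ℝ := fun n => s₀ / (n + 2) with hε
  have hεpos : ∀ n, 0 < ε n := fun n => by positivity
  have hεlt : ∀ n, ε n < s₀ := fun n => by
    rw [hε]; dsimp only
    rw [div_lt_iff₀ (by positivity)]; nlinarith
  have hε2 : ∀ n, s₀ + 2 * ε n ≤ 2 * s₀ := fun n => by
    rw [hε]; dsimp only
    rw [show s₀ / (n + 2 : ℝ) = s₀ * (1 / (n + 2)) by ring]
    have : (1 : ℝ) / (n + 2) ≤ 1 / 2 :=
      one_div_le_one_div_of_le (by norm_num) (by have := n.cast_nonneg (α := ℝ); linarith)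
    nlinarith
  have hεto : Tendsto ε atTop (𝓝 0) := by
    have h := (tendsto_const_div_atTop_nhds_zero_nat s₀).comp (tendsto_add_atTop_nat 2)
    refine h.congr fun n => ?_
    simp only [Function.comp_apply, hε, Nat.cast_add, Nat.cast_ofNat]
  -- the mollified kernels
  have H : ∀ n : ℕ, ∃ (b κ : E4 → ℝ),
      ContDiff ℝ ∞ b ∧ HasCompactSupport b ∧ (∀ u, 0 ≤ b u) ∧ (∫ u, b u = 1) ∧ (∀ u, b u ≠ 0 → ‖u‖ < ε n) ∧
      (∀ (R : E4 ≃ₗᵢ[ℝ] E4) (u : E4), b (R u) = b u) ∧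
      Continuous κ ∧ (∀ w, |κ w| ≤ A * (1 + s₀⁻¹) ^ 8) ∧ (∀ w, κ (-(timeReflection 4 w)) = κ w) ∧
      (∀ w : E4, s₀ + 2 * ε n ≤ |w 0| →
        κ w = ∫ p : E4 × E4, K (w + timeReflection 4 p.2 - p.1) * (b p.1 * b p.2)) ∧
      (∀ g : E4 → ℝ, Continuous g → HasCompactSupport g →
        ∫ w, g w * κ w = ∫ p : E4 × E4, (b p.1 * b p.2) *
          ∫ ξ, g (ξ - timeReflection 4 p.2 + p.1) * (if s₀ ≤ ‖ξ‖ then K ξ else 0)) :=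
    fun n => exists_mollifiedKernel K hKm hKb hKP hs₀pos (hεpos n)
  choose b κ hbs hbc hb0 hb1 hbsupp hbR hκc hκb hκP hκK hκT using H
  have hκ2 : ∀ n (w : E4), 2 * s₀ ≤ |w 0| → κ n w = ∫ p : E4 × E4, K (w + θ p.2 - p.1) * (b n p.1 * b n p.2) :=
    fun n w hw => hκK n w ((hε2 n).trans hw)
  -- their Laplace–Fourier measures
  have H2 : ∀ n : ℕ, ∃ μ : Measure (ℝ × EuclideanSpace ℝ (Fin 3)), μ (Iio 0 ×ˢ univ) = 0 ∧ ∀ t : ℝ, 0 < t →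
      Integrable (fun p : ℝ × EuclideanSpace ℝ (Fin 3) => Real.exp (-(t * p.1))) μ ∧
      ∀ z : EuclideanSpace ℝ (Fin 3), κ n (ofTimeSpace (-(2 * s₀ + t)) z) =
        ∫ p : ℝ × EuclideanSpace ℝ (Fin 3), Real.exp (-(t * p.1)) * Real.cos ⟪p.2, z⟫_ℝ ∂μ :=
    fun n => exists_laplaceFourier_mollified S₁ hRP K hrep (b n) (κ n) (hbs n) (hεpos n) (hbsupp n) (hεlt n) (hκ2 n)
      (hκc n) (hκP n) (hκb n)
  choose μ hμ0 hμ using H2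
  -- a.e. `E ≥ 0` under `μ n`
  have hμpos : ∀ n, ∀ᵐ p ∂(μ n), (0 : ℝ) ≤ p.1 := by
    intro n
    have h := measure_eq_zero_iff_ae_notMem.1 (hμ0 n)
    filter_upwards [h] with p hp
    by_contra hneg
    exact hp ⟨not_le.1 hneg, mem_univ _⟩
  -- the tilted finite measures `νₙ = e^{-s₀ E} μₙ`
  set dens : ℝ × EuclideanSpace ℝ (Fin 3) → ℝ≥0 := fun p => (Real.exp (-(s₀ * p.1))).toNNReal with hdens
  have hdens_m : Measurable dens := by fun_prop
  set ν : ℕ → Measure (ℝ × EuclideanSpace ℝ (Fin 3)) := fun n => (μ n).withDensity (fun p => (dens p : ℝ≥0∞)) with hν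
  have hνfin : ∀ n, IsFiniteMeasure (ν n) := fun n =>
    isFiniteMeasure_withDensity_ofReal ((hμ n s₀ hs₀pos).1.hasFiniteIntegral)
  have hν_int : ∀ n (f : ℝ × EuclideanSpace ℝ (Fin 3) → ℝ),
      ∫ p, f p ∂(ν n) = ∫ p, Real.exp (-(s₀ * p.1)) * f p ∂(μ n) := by
    intro n f
    simp only [hν]
    rw [integral_withDensity_eq_integral_smul hdens_m]
    refine integral_congr_ae (Eventually.of_forall fun p => ?_)
    simp only [hdens, NNReal.smul_def, smul_eq_mul, Real.coe_toNNReal _ (Real.exp_pos _).le]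
  have hν_mass : ∀ n, (ν n) univ = ENNReal.ofReal (κ n (ofTimeSpace (-(2 * s₀ + s₀)) 0)) := by
    intro n
    simp only [hν]
    rw [withDensity_apply _ MeasurableSet.univ, Measure.restrict_univ]
    have h1 : ∫⁻ p, (dens p : ℝ≥0∞) ∂(μ n) = ENNReal.ofReal (∫ p, Real.exp (-(s₀ * p.1)) ∂(μ n)) := by
      rw [ofReal_integral_eq_lintegral_ofReal (hμ n s₀ hs₀pos).1 (Eventually.of_forall fun p => (Real.exp_pos _).le)]
      simp only [hdens]; rfl
    rw [h1, (hμ n s₀ hs₀pos).2 0]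
    congr 1
    refine integral_congr_ae (Eventually.of_forall fun p => ?_)
    simp
  set νF : ℕ → FiniteMeasure (ℝ × EuclideanSpace ℝ (Fin 3)) := fun n => ⟨ν n, hνfin n⟩ with hνF
  have hνF_coe : ∀ n, ((νF n : FiniteMeasure _) : Measure (ℝ × EuclideanSpace ℝ (Fin 3))) = ν n := fun n => rfl
  set C : ℝ≥0 := B.toNNReal with hC
  have hνF_mass : ∀ n, (νF n).mass ≤ C := by
    intro n
    have h1 : ((νF n).mass : ℝ≥0∞) = ENNReal.ofReal (κ n (ofTimeSpace (-(2 * s₀ + s₀)) 0)) := by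
      rw [FiniteMeasure.ennreal_mass]; exact hν_mass n
    have h2 : κ n (ofTimeSpace (-(2 * s₀ + s₀)) 0) ≤ B := (le_abs_self _).trans (hκb n _)
    have h3 : ((νF n).mass : ℝ≥0∞) ≤ ENNReal.ofReal B := by rw [h1]; exact ENNReal.ofReal_le_ofReal h2
    exact ENNReal.coe_le_coe.1 h3
  obtain ⟨νlim, -, hcl⟩ := exists_finiteMeasure_mapClusterPt νF C hνF_mass
  -- the continuous candidate
  set Kt : ℝ × EuclideanSpace ℝ (Fin 3) → ℝ := fun x =>
    ∫ p, Real.exp (min p.1 0 - max x.1 0 * max p.1 0) * Real.cos ⟪p.2, x.2⟫_ℝ ∂(νlim : Measure (ℝ × EuclideanSpace ℝ (Fin 3)))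
    with hKt
  have hKtc : Continuous Kt := continuous_lfEval _
  have hKtb : ∀ x, |Kt x| ≤ (νlim : Measure (ℝ × EuclideanSpace ℝ (Fin 3))).real univ := by
    intro x
    have h := norm_integral_le_of_norm_le_const (μ := (νlim : Measure (ℝ × EuclideanSpace ℝ (Fin 3)))) (C := 1)
      (f := fun p : ℝ × EuclideanSpace ℝ (Fin 3) => Real.exp (min p.1 0 - max x.1 0 * max p.1 0) * Real.cos ⟪p.2, x.2⟫_ℝ)
      (Eventually.of_forall fun p => by rw [Real.norm_eq_abs]; exact abs_lfIntegrand_le_one x p)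
    rw [one_mul, Real.norm_eq_abs] at h
    exact h
  -- the shifted time–space equivalence and its inverse coordinates
  obtain ⟨W, hW, hW_apply⟩ := exists_shiftedTimeSpace_equiv δ
  have hWc : Continuous (W : (ℝ × EuclideanSpace ℝ (Fin 3)) → E4) := by
    rw [show ((W : (ℝ × EuclideanSpace ℝ (Fin 3)) → E4)) = fun p => ofTimeSpace (-(δ + p.1)) p.2 from funext hW_apply]
    exact continuous_shiftedTimeSpace δ
  have hW0 : ∀ x, (W x) 0 = -(δ + x.1) := fun x => by rw [hW_apply, ofTimeSpace_apply_zero]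
  have hWsp : ∀ x, spaceC 3 (W x) = x.2 := fun x => by rw [hW_apply, spaceC_ofTimeSpace]
  set Ainv : E4 → ℝ × EuclideanSpace ℝ (Fin 3) := fun y => (-y 0 - δ, spaceC 3 y) with hAinv
  have hAinv_c : Continuous Ainv := by
    refine Continuous.prodMk ?_ (spaceC 3).continuous
    exact ((EuclideanSpace.proj (0 : Fin 4) : E4 →L[ℝ] ℝ).continuous.neg).sub continuous_const
  have hAinv_W : ∀ x, Ainv (W x) = x := fun x => by
    refine Prod.ext ?_ ?_
    · show -(W x) 0 - δ = x.1; rw [hW0]; ring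
    · exact hWsp x
  have hW_Ainv : ∀ y, W (Ainv y) = y := fun y => by
    rw [hW_apply]
    show ofTimeSpace (-(δ + (-y 0 - δ))) (spaceC 3 y) = y
    rw [show -(δ + (-y 0 - δ)) = y 0 by ring]; exact ofTimeSpace_apply_zero_spaceC y
  -- on the positive half `x₁ > 0`: `‖W x‖ ≥ s₀`, hence `|K (W x)| ≤ B`
  have hWnorm : ∀ x : ℝ × EuclideanSpace ℝ (Fin 3), 0 < x.1 → s₀ ≤ ‖W x‖ := by
    intro x hx
    have e1 : |(W x) 0| ≤ ‖W x‖ := by simpa [Real.norm_eq_abs] using PiLp.norm_apply_le (p := 2) (W x) 0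
    rw [hW0, abs_of_neg (by linarith)] at e1
    linarith
  have hKW : ∀ x : ℝ × EuclideanSpace ℝ (Fin 3), 0 < x.1 → |K (W x)| ≤ B := by
    intro x hx
    have h := hK'b (W x)
    simp only [hK', if_pos (hWnorm x hx)] at h
    exact h
  -- ★ the identification against positive-time test functions
  have hident : ∀ χ : ℝ × EuclideanSpace ℝ (Fin 3) → ℝ, Continuous χ → HasCompactSupport χ → tsupport χ ⊆ Ioi 0 ×ˢ univ →
      ∫ x, χ x * K (W x) = ∫ x, χ x * Kt x := by
    intro χ hχ hχc hχU
    have hχi : Integrable χ := hχ.integrable_of_hasCompactSupport hχc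
    have hχpos : ∀ x, χ x ≠ 0 → 0 < x.1 := fun x hx => (hχU (subset_tsupport _ hx)).1
    obtain ⟨Φ, hΦ, hΦ0⟩ := exists_lfTest χ hχ hχc hχU
    -- (b) `∫ Φ dνₙ = ∫ χ (κₙ ∘ W)`
    have hb : ∀ n, ∫ p, Φ p ∂(νF n : Measure (ℝ × EuclideanSpace ℝ (Fin 3))) = ∫ x, χ x * κ n (W x) := by
      intro n
      haveI := hνfin n
      rw [hνF_coe, integral_congr_ae (Eventually.of_forall hΦ), integral_lfTest_eq χ hχ hχc (ν n)]
      refine integral_congr_ae (Eventually.of_forall fun x => ?_)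
      beta_reduce
      by_cases hx : χ x = 0
      · simp [hx]
      congr 1
      have hxt : 0 < x.1 := hχpos x hx
      rw [hν_int n, hW_apply, show -(δ + x.1) = -(2 * s₀ + (s₀ + x.1)) by rw [← hδs]; ring,
        (hμ n (s₀ + x.1) (by linarith)).2 x.2]
      refine integral_congr_ae ?_
      filter_upwards [hμpos n] with p hp
      rw [min_eq_right hp, max_eq_left hxt.le, max_eq_left hp, ← mul_assoc, ← Real.exp_add]
      congr 2; ring
    -- (c) `∫ χ (κₙ ∘ W) → L := ∫ χ (K ∘ W)`
    set g : E4 → ℝ := fun y => χ (Ainv y) with hgdef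
    have hg : Continuous g := hχ.comp hAinv_c
    have hgW : ∀ x, g (W x) = χ x := fun x => by simp only [hgdef, hAinv_W]
    have hgc : HasCompactSupport g := by
      refine HasCompactSupport.intro (hχc.isCompact.image hWc) fun y hy => ?_
      by_contra hne
      exact hy ⟨Ainv y, subset_tsupport _ hne, hW_Ainv y⟩
    have hgK : ∀ y, g y * K y = g y * K' y := by
      intro y
      by_cases hy : g y = 0
      · simp [hy]
      · have hpos : 0 < (Ainv y).1 := hχpos _ hy
        have : s₀ ≤ ‖y‖ := by have := hWnorm (Ainv y) hpos; rwa [hW_Ainv] at this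
        simp only [hK', if_pos this]
    have ha_eq : ∀ n, ∫ x, χ x * κ n (W x) = ∫ y, g y * κ n y := by
      intro n
      rw [← hW.integral_comp' (fun y => g y * κ n y)]
      exact integral_congr_ae (Eventually.of_forall fun x => by beta_reduce; rw [hgW])
    have hL_eq : ∫ x, χ x * K (W x) = ∫ y, g y * K' y := by
      rw [← hW.integral_comp' (fun y => g y * K' y)]
      exact integral_congr_ae (Eventually.of_forall fun x => by beta_reduce; rw [← hgK, hgW])
    have hconv : Tendsto (fun n => ∫ x, χ x * κ n (W x)) atTop (𝓝 (∫ x, χ x * K (W x))) := by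
      have h := tendsto_bumpAverage K' (Measurable.ite (measurableSet_le measurable_const measurable_norm) hKm measurable_const)
        hB0 hK'b g hg hgc b (fun n => (hbs n).continuous) hbc hb0 hb1 ε hεpos hbsupp hεto
      rw [hL_eq]
      refine h.congr fun n => ?_
      rw [ha_eq n, hκT n g hg hgc]
    -- (d) the cluster value is the limit; (e) Fubini against the limit measure
    have hd : ∫ p, Φ p ∂(νlim : Measure (ℝ × EuclideanSpace ℝ (Fin 3))) = ∫ x, χ x * K (W x) := by
      have h := hcl Φ hΦ0
      rw [show (fun n => ∫ p, Φ p ∂(νF n : Measure (ℝ × EuclideanSpace ℝ (Fin 3)))) = fun n => ∫ x, χ x * κ n (W x)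
        from funext hb] at h
      exact eq_of_mapClusterPt_of_tendsto h hconv
    rw [← hd, integral_congr_ae (Eventually.of_forall hΦ), integral_lfTest_eq χ hχ hχc]
  -- (f) a.e. on the positive half-space `U = {t > 0}`
  set U : Set (ℝ × EuclideanSpace ℝ (Fin 3)) := Ioi 0 ×ˢ univ with hU
  have hUo : IsOpen U := isOpen_Ioi.prod isOpen_univ
  set F : ℝ × EuclideanSpace ℝ (Fin 3) → ℝ := fun x => if 0 < x.1 then K (W x) - Kt x else 0 with hF
  have hFm : Measurable F := by
    refine Measurable.ite (measurableSet_lt measurable_const measurable_fst) ?_ measurable_const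
    exact (hKm.comp W.measurable).sub hKtc.measurable
  set M : ℝ := B + (νlim : Measure (ℝ × EuclideanSpace ℝ (Fin 3))).real univ with hM
  have hFb : ∀ x, ‖F x‖ ≤ M := by
    intro x
    simp only [hF]
    split_ifs with hx
    · rw [Real.norm_eq_abs]
      exact (abs_sub _ _).trans (add_le_add (hKW x hx) (hKtb x))
    · rw [norm_zero, hM]; exact add_nonneg hB0 measureReal_nonneg
  have hFli : LocallyIntegrableOn F U volume :=
    ((memLp_top_of_bound hFm.aestronglyMeasurable M (Eventually.of_forall hFb)).locallyIntegrable le_top).locallyIntegrableOn U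
  have hFae : ∀ᵐ x : ℝ × EuclideanSpace ℝ (Fin 3), x ∈ U → F x = 0 := by
    refine hUo.ae_eq_zero_of_integral_contDiff_smul_eq_zero hFli fun χ hχs hχc hχU => ?_
    have hχ : Continuous χ := hχs.continuous
    have hχpos : ∀ x, χ x ≠ 0 → 0 < x.1 := fun x hx => (hχU (subset_tsupport _ hx)).1
    have hsmul : ∀ x, χ x • F x = χ x * K (W x) - χ x * Kt x := by
      intro x
      rw [smul_eq_mul]
      by_cases hx : χ x = 0
      · simp [hx]
      · simp only [hF, if_pos (hχpos x hx)]; ring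
    have hi1 : Integrable (fun x => χ x * K (W x)) := by
      refine ((hχ.integrable_of_hasCompactSupport hχc).norm.mul_const B).mono'
        ((hχ.measurable.mul (hKm.comp W.measurable)).aestronglyMeasurable) (Eventually.of_forall fun x => ?_)
      rw [norm_mul]
      by_cases hx : χ x = 0
      · simp [hx]
      · exact mul_le_mul_of_nonneg_left (by rw [Real.norm_eq_abs]; exact hKW x (hχpos x hx)) (norm_nonneg _)
    have hi2 : Integrable (fun x => χ x * Kt x) := (hχ.mul hKtc).integrable_of_hasCompactSupport (hχc.mul_right)
    rw [show (fun x => χ x • F x) = fun x => χ x * K (W x) - χ x * Kt x from funext hsmul, integral_sub hi1 hi2,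
      hident χ hχ hχc hχU, sub_self]
  -- (g) transport to `ℝ⁴`
  refine ⟨fun y => Kt (Ainv y), hKtc.comp hAinv_c, ?_⟩
  have hmap : ∀ᵐ y ∂(Measure.map W volume), y 0 < -δ → K y = Kt (Ainv y) := by
    rw [W.measurableEmbedding.ae_map_iff]
    filter_upwards [hFae] with x hx
    intro hy
    have hx1 : 0 < x.1 := by rw [hW0] at hy; linarith
    have h := hx ⟨hx1, mem_univ _⟩
    simp only [hF, if_pos hx1] at h
    rw [hAinv_W]; linarith
  rwa [hW.map_eq] at hmap

end Summit.QuantumFields.YangMills.Theorems.F4SubCurvatureDoorSubCurvatureKernelHalfSpace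

end
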